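import Mathlib
import HarnessLib

/-!
# Route `TautLoopKelvin`, crux `TautLoopLaw` (stmt-NavierStokesRegularity-15249), line
  `Sketch-ideas-r1k1` (Dini–Saks architecture) — tools stub `stub_tautLoopStepCompositeTools`

**`n`-fold composites of `C¹` near-identity maps.** Given maps `Φ₀, …, Φₙ₋₁ : E → E` of class
`C¹` with `‖Φₖ x − x‖ ≤ D`, and the composites `Ψₖ = Φₖ ∘ Φₖ₊₁ ∘ ⋯ ∘ Φₙ₋₁` presented through
the recursion `Ψₙ = id`, `Ψₖ = Φₖ ∘ Ψₖ₊₁` (`k < n`), we prove by downward induction on `k`: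

* each `Ψₖ` (`k ≤ n`) is of class `C¹`;
* the displacement bound `‖Ψₖ x − x‖ ≤ (n − k) D`;
* the chain rule `D(Ψ₀)(x) = DΦ₀(Ψ₁ x) ∘ DΦ₁(Ψ₂ x) ∘ ⋯ ∘ DΦₙ₋₁(Ψₙ x)`, written as the
  `List.prod` of a `List.ofFn` in the ring of continuous linear endomorphisms (multiplication
  is composition).

Everything is folklore (first-year calculus).
-/

namespace Summit.NavierStokesRegularity.NavierStokesRegularity.Theorems

set_option linter.dupNamespace false

/-- The downward induction behind `stub_tautLoopStepCompositeTools`, phrased as an upward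
induction on `m` with `k + m = n`: if `Ψ n = id` and `Ψ k = Φ k ∘ Ψ (k + 1)` for `k < n`, where
every `Φ k` (`k < n`) is of class `C¹` and moves points by at most `D`, then `Ψ k` is of class
`C¹`, moves points by at most `m D`, and its differential at `x` is the ordered product
`Πⱼ DΦ_{k+j}(Ψ_{k+j+1} x)` over `j < m` (product = composition of continuous linear maps).
[folklore] -/
theorem tautLoopComp_induction {E : Type*} [NormedAddCommGroup E] [NormedSpace ℝ E]
    {n : ℕ} {Φ Ψ : ℕ → E → E} {D : ℝ}
    (hΦ : ∀ k, k < n → ContDiff ℝ 1 (Φ k)) (hΦD : ∀ k, k < n → ∀ x, ‖Φ k x - x‖ ≤ D)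
    (hid : ∀ x, Ψ n x = x) (hrec : ∀ k, k < n → ∀ x, Ψ k x = Φ k (Ψ (k + 1) x)) :
    ∀ m k : ℕ, k + m = n →
      ContDiff ℝ 1 (Ψ k) ∧ (∀ x, ‖Ψ k x - x‖ ≤ m * D) ∧
      (∀ x, fderiv ℝ (Ψ k) x =
        (List.ofFn (fun j : Fin m => fderiv ℝ (Φ (k + j)) (Ψ (k + j + 1) x))).prod) := by
  intro m
  induction m with
  | zero =>
    intro k hk
    obtain rfl : k = n := by simpa using hk
    have hΨ : Ψ k = id := funext hid
    refine ⟨by rw [hΨ]; exact contDiff_id, fun x => ?_, fun x => ?_⟩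
    · rw [hid x, sub_self, norm_zero, Nat.cast_zero, zero_mul]
    · rw [List.ofFn_zero, List.prod_nil, hΨ, fderiv_id]
      rfl
  | succ m ih =>
    intro k hk
    have hkn : k < n := by omega
    obtain ⟨h1, h2, h3⟩ := ih (k + 1) (by omega)
    have hΨ : Ψ k = Φ k ∘ Ψ (k + 1) := funext (hrec k hkn)
    refine ⟨by rw [hΨ]; exact (hΦ k hkn).comp h1, fun x => ?_, fun x => ?_⟩
    · rw [hrec k hkn x]
      calc ‖Φ k (Ψ (k + 1) x) - x‖
          = ‖(Φ k (Ψ (k + 1) x) - Ψ (k + 1) x) + (Ψ (k + 1) x - x)‖ := by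
            rw [sub_add_sub_cancel]
        _ ≤ ‖Φ k (Ψ (k + 1) x) - Ψ (k + 1) x‖ + ‖Ψ (k + 1) x - x‖ := norm_add_le _ _
        _ ≤ D + m * D := add_le_add (hΦD k hkn _) (h2 x)
        _ = ((m + 1 : ℕ) : ℝ) * D := by push_cast; ring
    · have e1 : ∀ j : Fin m, k + (j.succ : ℕ) = k + 1 + j := fun j => by
        rw [Fin.val_succ]; omega
      rw [hΨ, (((hΦ k hkn).differentiable one_ne_zero _).hasFDerivAt.comp x
          (h1.differentiable one_ne_zero x).hasFDerivAt).fderiv, List.ofFn_succ, List.prod_cons]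
      simp only [Fin.val_zero, Nat.add_zero, e1]
      rw [h3 x]
      rfl

/-- **Composites of `C¹` near-identity maps (tools stub `stub_tautLoopStepCompositeTools`).**
Let `Φ₀, …, Φₙ₋₁ : ℝ³ → ℝ³` be of class `C¹` with `‖Φₖ x − x‖ ≤ D` (`D ≥ 0`), and let `Ψₖ` be
given by `Ψₙ = id`, `Ψₖ = Φₖ ∘ Ψₖ₊₁` (`k < n`), i.e. `Ψₖ = Φₖ ∘ ⋯ ∘ Φₙ₋₁`. Then every `Ψₖ`
(`k ≤ n`) is of class `C¹`, `‖Ψₖ x − x‖ ≤ (n − k) D`, and the differential of the full composite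
is the ordered product of the factors' differentials along the orbit:
`D(Ψ₀)(x) = DΦ₀(Ψ₁ x) ∘ DΦ₁(Ψ₂ x) ∘ ⋯ ∘ DΦₙ₋₁(Ψₙ x)` (a `List.prod` in the ring of continuous
linear endomorphisms of `ℝ³`). [folklore] -/
theorem stub_tautLoopStepCompositeTools : ∀ (n : ℕ)
    (Φ : ℕ → EuclideanSpace ℝ (Fin 3) → EuclideanSpace ℝ (Fin 3))
    (Ψ : ℕ → EuclideanSpace ℝ (Fin 3) → EuclideanSpace ℝ (Fin 3)) (D : ℝ), 0 ≤ D →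
    (∀ k, k < n → ContDiff ℝ 1 (Φ k)) → (∀ k, k < n → ∀ x, ‖Φ k x - x‖ ≤ D) →
    (∀ x, Ψ n x = x) → (∀ k, k < n → ∀ x, Ψ k x = Φ k (Ψ (k + 1) x)) →
    (∀ k, k ≤ n → ContDiff ℝ 1 (Ψ k)) ∧ (∀ k, k ≤ n → ∀ x, ‖Ψ k x - x‖ ≤ (n - k) * D) ∧
    (∀ x, fderiv ℝ (Ψ 0) x
      = (List.ofFn (fun k : Fin n => fderiv ℝ (Φ k) (Ψ (k + 1) x))).prod) := by
  intro n Φ Ψ D _ hΦ hΦD hid hrec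
  have key := tautLoopComp_induction hΦ hΦD hid hrec
  refine ⟨fun k hk => (key (n - k) k (by omega)).1, fun k hk x => ?_, fun x => ?_⟩
  · have h := (key (n - k) k (by omega)).2.1 x
    rwa [Nat.cast_sub hk] at h
  · have h := (key n 0 (by omega)).2.2 x
    simpa only [Nat.zero_add] using h

end Summit.NavierStokesRegularity.NavierStokesRegularity.Theorems
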